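import Summits.Ventures.Crystal3D.Theorems.StickyWulffConstantNoReconstructionGainExactPrep
import Summits.Ventures.Crystal3D.LocalLP.ClassicalInputsDischarged
import HarnessLib

/-!
# The isoperimetric deficiency bound in `Finset` currency (line `replication-exactness`, brick for the residual)

HONEST FRAMING. Part of the venture `Summits/Ventures/Crystal3D` (cell `crystal3d-full`), supports the
crux `NoReconstructionGain` (stmt-Ventures-19144, route `route-Ventures-StickyWulffConstant`), line
`replication-exactness` (lead wulff-p1 g17).  The cell's Lévy rung `numContacts_lt_levy`
(`C(x) < 6N − 1.67 N^{2/3}`, proved in `LocalLP/ClassicalInputsDischarged` from the Federer isoperimetric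
input) in the `Finset`/`contactDeficiency` currency used by the crux chain:

* `levy_lt_contactDeficiency` — every finite set of `≥ 2` centres pairwise `≥ 1` apart has
  `D(S) > 1.67 · (#S)^{2/3}`.

This is the isoperimetric input for the CONFINEMENT attack on the residual `stub_manyWrappedCoreAdhesion`
(blocks of a core far from the sample have deficiency `≳ #^{2/3}` but are bound only across a thin shell).

WHAT THIS IS NOT: any confinement statement; rung F-C1 not moved.
-/

noncomputable section

namespace Summit.Ventures.Crystal3D.Theorems

open Summit.Ventures.Crystal3D
open Literature.MathematicalPhysics.StatisticalMechanics (contactDeficiency)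
open Finset

/-- **Lévy's bound in deficiency currency**: `1.67 · (#S)^{2/3} < D(S)` for a finite packing of `≥ 2`
balls. -/
theorem levy_lt_contactDeficiency (S : Finset (EuclideanSpace ℝ (Fin 3)))
    (hS : ∀ p ∈ S, ∀ q ∈ S, p ≠ q → 1 ≤ dist p q) (h2 : 2 ≤ S.card) :
    167 / 100 * (S.card : ℝ) ^ ((2 : ℝ) / 3) < contactDeficiency S := by
  classical
  set N := S.card with hN
  set x : Fin N → EuclideanSpace ℝ (Fin 3) := fun i => ((S.equivFin.symm i : S) : _) with hxdef
  have hxinj : Function.Injective x := fun i j h => S.equivFin.symm.injective (Subtype.ext h)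
  have hmem : ∀ i, x i ∈ S := fun i => (S.equivFin.symm i).2
  have himage : univ.image x = S := by
    ext p
    simp only [mem_image, mem_univ, true_and]
    constructor
    · rintro ⟨i, rfl⟩; exact hmem i
    · intro hp; exact ⟨S.equivFin ⟨p, hp⟩, by simp [hxdef]⟩
  have hpack : IsUnitPacking x := fun i j hij => hS _ (hmem i) _ (hmem j) (fun h => hij (hxinj h))
  have h := numContacts_lt_levy h2 x hpack
  rw [← himage, contactDeficiency_image_eq x hxinj]
  linarith

end Summit.Ventures.Crystal3D.Theorems

end
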